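import Mathlib

/-!
# Harris on a product cube, from Mathlib's FKG inequality (blind cell PercRepro2, p3 g23,
2026-08-28; `proofs/P3-HARRIS.md` §4)

The only inequality used by the Harris proof of the single-`d` class theorem: on the cube
`{x ≤ c}` of a finite distributive lattice (a sublattice, so its indicator is log-supermodular),
Mathlib's `fkg` gives the Harris inequality for functions monotone on the cube
(`sum_mul_sum_le_card_mul_sum`, `card_mul_sum_mul_le`), and hence the **tilt lemma**
`sum_sub_comp_mul_nonneg`: for an antitone involution `κ` of the cube (the cube complement) and
`f`, `h` monotone and non-negative on the cube, `Σ_{x ≤ c} (f x − f (κ x)) · h x ≥ 0`.  With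
`f = 1[p ~_Y q]` (so `f ∘ κ = 1[p ~_W q]`) and `h` the indicator of an up-set this is
«Σ_U (Ỹc − W̃c) ≥ 0»; with `h = 1[r ~_W s]` it is the class-level inequality of §6.  Own work;
std axioms.
-/

namespace Summit.Ventures.PercRepro2

namespace HarrisCube

open Finset Classical

variable {α : Type*} [DistribLattice α]

section Cube

variable [Fintype α]

/-- The cube below `c`, as a finset. -/
noncomputable def cube (c : α) : Finset α := univ.filter (fun x => x ≤ c)

/-- Membership in the cube. -/
lemma mem_cube {c x : α} : x ∈ cube c ↔ x ≤ c := by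
  simp [cube]

/-- The cube contains its top. -/
lemma cube_nonempty (c : α) : (cube c).Nonempty := ⟨c, mem_cube.2 le_rfl⟩

/-- The cube has positive cardinality. -/
lemma cube_card_pos (c : α) : 0 < (cube c).card := Finset.card_pos.2 (cube_nonempty c)

end Cube

/-- The indicator of the cube: a log-supermodular weight. -/
noncomputable def μ (c : α) : α → ℤ := fun x => if x ≤ c then 1 else 0

/-- `μ c` on the cube. -/
lemma μ_apply_of_le {c x : α} (h : x ≤ c) : μ c x = 1 := by
  simp [μ, h]

/-- `μ c` off the cube. -/
lemma μ_apply_of_not_le {c x : α} (h : ¬ x ≤ c) : μ c x = 0 := by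
  simp [μ, h]

/-- `μ c ≥ 0`. -/
lemma μ_nonneg (c : α) : 0 ≤ μ c := by
  intro x
  by_cases h : x ≤ c
  · simp [μ_apply_of_le h]
  · simp [μ_apply_of_not_le h]

/-- `μ c` is log-supermodular: the cube is a sublattice. -/
lemma μ_supermodular (c : α) (a b : α) : μ c a * μ c b ≤ μ c (a ⊓ b) * μ c (a ⊔ b) := by
  by_cases ha : a ≤ c
  · by_cases hb : b ≤ c
    · rw [μ_apply_of_le ha, μ_apply_of_le hb, μ_apply_of_le (inf_le_of_left_le ha),
        μ_apply_of_le (sup_le ha hb)]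
    · rw [μ_apply_of_not_le hb, mul_zero]
      exact mul_nonneg (μ_nonneg c _) (μ_nonneg c _)
  · rw [μ_apply_of_not_le ha, zero_mul]
    exact mul_nonneg (μ_nonneg c _) (μ_nonneg c _)

/-- Clamp a function to the cube: `x ↦ f (x ⊓ c)`. -/
def clamp (c : α) (f : α → ℤ) : α → ℤ := fun x => f (x ⊓ c)

/-- The clamp is the identity on the cube. -/
lemma clamp_of_le {c : α} (f : α → ℤ) {x : α} (h : x ≤ c) : clamp c f x = f x := by
  simp [clamp, inf_eq_left.2 h]

/-- The clamp of a function monotone on the cube is monotone. -/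
lemma clamp_monotone {c : α} {f : α → ℤ} (hf : MonotoneOn f (Set.Iic c)) :
    Monotone (clamp c f) := by
  intro x y hxy
  exact hf (Set.mem_Iic.2 inf_le_right) (Set.mem_Iic.2 inf_le_right) (inf_le_inf_right c hxy)

/-- The clamp of a function non-negative on the cube is non-negative. -/
lemma clamp_nonneg {c : α} {f : α → ℤ} (hf : ∀ x, x ≤ c → 0 ≤ f x) : 0 ≤ clamp c f :=
  fun _ => hf _ inf_le_right

variable [Fintype α]

/-- A sum weighted by `μ c` is a sum over the cube. -/
lemma sum_μ_mul (c : α) (F : α → ℤ) : ∑ x, μ c x * F x = ∑ x ∈ cube c, F x := by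
  rw [cube, Finset.sum_filter]
  refine Finset.sum_congr rfl fun x _ => ?_
  by_cases h : x ≤ c
  · simp [μ_apply_of_le h, h]
  · simp [μ_apply_of_not_le h, h]

/-- The total mass of `μ c` is the size of the cube. -/
lemma sum_μ (c : α) : ∑ x, μ c x = (cube c).card := by
  have := sum_μ_mul c (fun _ => (1 : ℤ))
  simp only [mul_one, Finset.sum_const] at this
  simpa using this

/-- A `μ c`-weighted sum of a clamped function is the sum over the cube. -/
lemma sum_μ_mul_clamp (c : α) (f : α → ℤ) : ∑ x, μ c x * clamp c f x = ∑ x ∈ cube c, f x := by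
  rw [sum_μ_mul]
  exact Finset.sum_congr rfl fun x hx => clamp_of_le f (mem_cube.1 hx)

/-- **Harris on the cube, increasing–increasing**: for `f, g ≥ 0` monotone on `{x ≤ c}`,
`(Σ f)(Σ g) ≤ |cube| · Σ f g`. -/
theorem sum_mul_sum_le_card_mul_sum (c : α) {f g : α → ℤ} (hf0 : ∀ x, x ≤ c → 0 ≤ f x)
    (hg0 : ∀ x, x ≤ c → 0 ≤ g x) (hf : MonotoneOn f (Set.Iic c)) (hg : MonotoneOn g (Set.Iic c)) :
    (∑ x ∈ cube c, f x) * (∑ x ∈ cube c, g x) ≤ (cube c).card * ∑ x ∈ cube c, f x * g x := by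
  have h := fkg (clamp c f) (clamp c g) (μ c) (μ_nonneg c) (clamp_nonneg hf0) (clamp_nonneg hg0)
    (clamp_monotone hf) (clamp_monotone hg) (μ_supermodular c)
  rw [sum_μ_mul_clamp, sum_μ_mul_clamp, sum_μ, sum_μ_mul] at h
  refine h.trans (le_of_eq ?_)
  congr 1
  exact Finset.sum_congr rfl fun x hx => by
    rw [clamp_of_le f (mem_cube.1 hx), clamp_of_le g (mem_cube.1 hx)]

/-- **Harris on the cube, increasing–decreasing**: for `f, g ≥ 0`, `f` monotone and `g` antitone
on `{x ≤ c}`, `|cube| · Σ f g ≤ (Σ f)(Σ g)`. -/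
theorem card_mul_sum_mul_le (c : α) {f g : α → ℤ} (hf0 : ∀ x, x ≤ c → 0 ≤ f x)
    (hg0 : ∀ x, x ≤ c → 0 ≤ g x) (hf : MonotoneOn f (Set.Iic c)) (hg : AntitoneOn g (Set.Iic c)) :
    (cube c).card * ∑ x ∈ cube c, f x * g x ≤ (∑ x ∈ cube c, f x) * (∑ x ∈ cube c, g x) := by
  -- apply the increasing–increasing form to `f` and `B − g`, `B := Σ g ≥ g` on the cube
  set B : ℤ := ∑ x ∈ cube c, g x with hB
  have hgB : ∀ x, x ≤ c → g x ≤ B := fun x hx =>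
    Finset.single_le_sum (fun y hy => hg0 y (mem_cube.1 hy)) (mem_cube.2 hx)
  have h := sum_mul_sum_le_card_mul_sum c (f := f) (g := fun x => B - g x) hf0
    (fun x hx => sub_nonneg.2 (hgB x hx)) hf
    (fun x hx y hy hxy => sub_le_sub_left (hg hx hy hxy) B)
  have e1 : ∑ x ∈ cube c, (B - g x) = (cube c).card * B - ∑ x ∈ cube c, g x := by
    rw [Finset.sum_sub_distrib, Finset.sum_const, nsmul_eq_mul]
  have e2 : ∑ x ∈ cube c, f x * (B - g x) = (∑ x ∈ cube c, f x) * B - ∑ x ∈ cube c, f x * g x := by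
    simp only [mul_sub, Finset.sum_sub_distrib, Finset.sum_mul]
  rw [e1, e2] at h
  nlinarith [h]

/-- Reindexing a sum over the cube by an involution of the cube. -/
lemma sum_comp_involution (c : α) {κ : α → α} (hκc : ∀ x, x ≤ c → κ x ≤ c)
    (hκκ : ∀ x, x ≤ c → κ (κ x) = x) (F : α → ℤ) :
    ∑ x ∈ cube c, F (κ x) = ∑ x ∈ cube c, F x := by
  refine Finset.sum_nbij' κ κ (fun x hx => mem_cube.2 (hκc x (mem_cube.1 hx)))
    (fun x hx => mem_cube.2 (hκc x (mem_cube.1 hx))) (fun x hx => hκκ x (mem_cube.1 hx))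
    (fun x hx => hκκ x (mem_cube.1 hx)) (fun x _ => rfl)

/-- **The tilt lemma.** For an antitone involution `κ` of the cube `{x ≤ c}` and `f, h ≥ 0`
monotone on the cube, `Σ_{x ≤ c} (f x − f (κ x)) · h x ≥ 0`.  (With `f = 1[p ~_Y q]`,
`f ∘ κ = 1[p ~_W q]`: `Σ_{cube} (Ỹc − W̃c) · h ≥ 0` for every non-negative increasing `h`.) -/
theorem sum_sub_comp_mul_nonneg (c : α) {κ : α → α} (hκc : ∀ x, x ≤ c → κ x ≤ c)
    (hκκ : ∀ x, x ≤ c → κ (κ x) = x) (hκ : AntitoneOn κ (Set.Iic c)) {f h : α → ℤ}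
    (hf0 : ∀ x, x ≤ c → 0 ≤ f x) (hh0 : ∀ x, x ≤ c → 0 ≤ h x) (hf : MonotoneOn f (Set.Iic c))
    (hh : MonotoneOn h (Set.Iic c)) :
    0 ≤ ∑ x ∈ cube c, (f x - f (κ x)) * h x := by
  have hN : (0 : ℤ) < (cube c).card := by exact_mod_cast cube_card_pos c
  -- Σ f (κ x) h x = Σ f y h (κ y)
  have hre : ∑ x ∈ cube c, f (κ x) * h x = ∑ x ∈ cube c, f x * h (κ x) := by
    have := sum_comp_involution c hκc hκκ (fun y => f y * h (κ y))
    rw [← this]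
    exact Finset.sum_congr rfl fun x hx => by rw [hκκ x (mem_cube.1 hx)]
  -- h ∘ κ is antitone and non-negative on the cube
  have hhκ0 : ∀ x, x ≤ c → 0 ≤ h (κ x) := fun x hx => hh0 _ (hκc x hx)
  have hhκ : AntitoneOn (fun x => h (κ x)) (Set.Iic c) := fun x hx y hy hxy =>
    hh (Set.mem_Iic.2 (hκc y hy)) (Set.mem_Iic.2 (hκc x hx)) (hκ hx hy hxy)
  have h1 := sum_mul_sum_le_card_mul_sum c hf0 hh0 hf hh
  have h2 := card_mul_sum_mul_le c hf0 hhκ0 hf hhκ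
  have h3 : ∑ x ∈ cube c, h (κ x) = ∑ x ∈ cube c, h x := sum_comp_involution c hκc hκκ h
  have key : ((cube c).card : ℤ) * ∑ x ∈ cube c, f x * h (κ x)
      ≤ (cube c).card * ∑ x ∈ cube c, f x * h x := by
    calc ((cube c).card : ℤ) * ∑ x ∈ cube c, f x * h (κ x)
        ≤ (∑ x ∈ cube c, f x) * ∑ x ∈ cube c, h (κ x) := h2
      _ = (∑ x ∈ cube c, f x) * ∑ x ∈ cube c, h x := by rw [h3]
      _ ≤ (cube c).card * ∑ x ∈ cube c, f x * h x := h1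
  have key' : ∑ x ∈ cube c, f x * h (κ x) ≤ ∑ x ∈ cube c, f x * h x :=
    le_of_mul_le_mul_left key hN
  have e : ∑ x ∈ cube c, (f x - f (κ x)) * h x
      = ∑ x ∈ cube c, f x * h x - ∑ x ∈ cube c, f (κ x) * h x := by
    simp only [sub_mul, Finset.sum_sub_distrib]
  rw [e, hre]
  exact sub_nonneg.2 key'

end HarrisCube

end Summit.Ventures.PercRepro2
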